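import Mathlib
import Literature.Probability.LatticeModels.TorusFourier
import HarnessLib

/-!
# Route `KLProgramme` — crux K3, child «VolumeLimit» (stmt-HubbardSuperconductivity-19921 `KLRegimeVolumeLimitV14`):
# two torus momentum grids and their COMMON REFINEMENT — exact pull-back of grid averages, and the two-volume
# comparison of GRID-ONLY families (cell gate-hubbard-kl, seat hubbard-kl-k3c4-p1 g5, technique «volume lemmas»;
# `--supports` the VolumeLimit child: the per-loop step of the engine's export `stub_vl_twoVolumeRate`)

Companion of `Literature.Probability.LatticeModels.BrillouinRiemannSumTwoVolume`
(`norm_momentumAverage_sub_momentumAverage_le`: two momentum averages `L^{-d} Σ_{k ∈ (ℤ/L)^d} G(2πk/L)` and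
`L'^{-d} Σ_{k'} G'(2πk'/L')` of CONTINUUM integrands `G, G'` Lipschitz on the zone are within
`2πK/L + 2πK'/L' + ‖G - G'‖_∞`).  In the two-volume comparison of quantities that are defined ONLY on the grids —
the kernels of the inductively defined finite-volume expansion (`klEffectiveAction L M …` at scale `n ≥ 1`), which are
not the samples of any continuum function — that lemma is not applicable: there is no integrand to be Lipschitz.
What such a family does carry (the invariant of the Cauchy route, `…VolumeLimitCauchy`, `stub_vl_twoVolumeRate`) is a
CROSS-VOLUME MODULUS: `‖F_L(k) - F_{L'}(k')‖ ≤ ε` whenever the two grid momenta `2πk/L`, `2πk'/L'` are close.  This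
file proves that this alone controls the averages (loop sums), with no continuum object at all:

* the COMMON REFINEMENT of the `L`- and `N`-grids is indexed by `j : Fin d → Fin (L * N)` (the grid `(2π/(LN)) ℤ^d`),
  with the two block coarsenings `j ↦ ⌊j_i / N⌋ ∈ ℤ/L` and `j ↦ ⌊j_i / L⌋ ∈ ℤ/N` (written inline as
  `fun i => ((j i / N : ℕ) : ZMod L)`; no definition is introduced);
* `abs_blockMomentum_sub_lt` — the two coarse momenta of one fine point are within `2π/L + 2π/N` of each other,
  coordinatewise (both lie in a half-open window of that length whose right end is the fine momentum);
* `sum_comp_blockCoarsen_left` / `_right` — **exact pull-back**: every fibre of a block coarsening has exactly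
  `N^d` (resp. `L^d`) points, so `Σ_j G(⌊j/N⌋) = N^d • Σ_k G k`; hence BOTH grid averages are averages over the
  SAME finite index set (`gridAverage_eq_fineAverage_left/right`);
* **`norm_gridAverage_sub_gridAverage_le`** — if `‖F k - F' k'‖ ≤ ε` for all pairs of grid points whose
  momenta are coordinatewise within `2π/L + 2π/L'`, then `‖L^{-d} Σ_k F k - L'^{-d} Σ_{k'} F' k'‖ ≤ ε`
  (average the pointwise bound over the common refinement);
* **`norm_gridAverage_sub_gridAverage_le_of_modulus`** — the linear-modulus instance: a family with
  `‖F_L(k) - F_{L'}(k')‖ ≤ ρ + D·Σ_i |2πk_i/L - 2πk'_i/L'|` has averages within `ρ + D·d·(2π/L + 2π/L')` —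
  LOOP SUMS PRESERVE TWO-VOLUME COMPARABILITY, the modulus constant turning into a rate (the termwise step of
  BGM 2006 §2.4 (2.38) «termwise limits of the finite-`L` recursions» in the Cauchy form of `twoVolumeRate_of_termwise`).

Everything is elementary finite combinatorics (`finProdFinEquiv` fibres); no measure theory; everything is proved; no
definitions.  Generic in the dimension `d` and the normed space `E`; the Hubbard instances (`d = 2`, torus distance
`torusAbs ≤ |·|`, the `(ρ, D)`-calculus of grid families) are in `…VolumeLimitGridFamilies`.
-/

noncomputable section

namespace Summit.HubbardSuperconductivity.HubbardSuperconductivity.Theorems.KLRegimeSplit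

set_option linter.dupNamespace false -- summit = problem name (single-conjunct summit), D-0017

open Finset Real Literature.Probability.LatticeModels

variable {d : ℕ} {E : Type*} [NormedAddCommGroup E] [NormedSpace ℝ E]

/-! ## §1 Block momenta: the two coarse momenta of one fine point are close -/

section Window

variable {L N : ℕ} [NeZero L] [NeZero N]

omit [NeZero L] in
/-- A fine index `a < L N` divided by the block length `N` is below `L`. -/
theorem div_lt_left_of_lt_mul {a : ℕ} (ha : a < L * N) : a / N < L :=
  (Nat.div_lt_iff_lt_mul (Nat.pos_of_ne_zero (NeZero.ne N))).2 ha

omit [NeZero N] in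
/-- A fine index `a < L N` divided by the block length `L` is below `N`. -/
theorem div_lt_right_of_lt_mul {a : ℕ} (ha : a < L * N) : a / L < N :=
  (Nat.div_lt_iff_lt_mul (Nat.pos_of_ne_zero (NeZero.ne L))).2 (ha.trans_eq (Nat.mul_comm L N))

/-- The left block momentum does not exceed the fine momentum: `2π⌊a/N⌋/L ≤ 2πa/(LN)`. -/
theorem blockMomentum_left_le (a : ℕ) :
    2 * π * ((a / N : ℕ) : ℝ) / L ≤ 2 * π * (a : ℝ) / ((L : ℝ) * N) := by
  have hL : (0 : ℝ) < L := by exact_mod_cast Nat.pos_of_ne_zero (NeZero.ne L)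
  have hN : (0 : ℝ) < N := by exact_mod_cast Nat.pos_of_ne_zero (NeZero.ne N)
  have hdiv : ((a / N : ℕ) : ℝ) * N ≤ (a : ℝ) := by exact_mod_cast Nat.div_mul_le_self a N
  rw [div_le_div_iff₀ hL (mul_pos hL hN)]
  calc 2 * π * ((a / N : ℕ) : ℝ) * ((L : ℝ) * N) = 2 * π * (((a / N : ℕ) : ℝ) * N) * L := by ring
    _ ≤ 2 * π * (a : ℝ) * L := by gcongr

/-- The fine momentum is below the next left block momentum: `2πa/(LN) < 2π⌊a/N⌋/L + 2π/L`. -/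
theorem fineMomentum_lt_blockMomentum_left_add (a : ℕ) :
    2 * π * (a : ℝ) / ((L : ℝ) * N) < 2 * π * ((a / N : ℕ) : ℝ) / L + 2 * π / L := by
  have hL : (0 : ℝ) < L := by exact_mod_cast Nat.pos_of_ne_zero (NeZero.ne L)
  have hN : (0 : ℝ) < N := by exact_mod_cast Nat.pos_of_ne_zero (NeZero.ne N)
  have hNpos : 0 < N := Nat.pos_of_ne_zero (NeZero.ne N)
  have hlt : (a : ℝ) < (((a / N : ℕ) : ℝ) + 1) * N := by
    have h' : (a : ℝ) < ((a / N * N + N : ℕ) : ℝ) := by exact_mod_cast Nat.lt_div_mul_add (a := a) hNpos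
    calc (a : ℝ) < ((a / N * N + N : ℕ) : ℝ) := h'
      _ = (((a / N : ℕ) : ℝ) + 1) * N := by push_cast; ring
  have hrhs : 2 * π * ((a / N : ℕ) : ℝ) / L + 2 * π / L = 2 * π * (((a / N : ℕ) : ℝ) + 1) / L := by ring
  rw [hrhs, div_lt_div_iff₀ (mul_pos hL hN) hL]
  calc 2 * π * (a : ℝ) * L < 2 * π * ((((a / N : ℕ) : ℝ) + 1) * N) * L := by gcongr
    _ = 2 * π * (((a / N : ℕ) : ℝ) + 1) * ((L : ℝ) * N) := by ring

/-- The right block momentum does not exceed the fine momentum: `2π⌊a/L⌋/N ≤ 2πa/(LN)`. -/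
theorem blockMomentum_right_le (a : ℕ) :
    2 * π * ((a / L : ℕ) : ℝ) / N ≤ 2 * π * (a : ℝ) / ((L : ℝ) * N) := by
  have h := blockMomentum_left_le (L := N) (N := L) a
  rwa [mul_comm (N : ℝ) (L : ℝ)] at h

/-- The fine momentum is below the next right block momentum: `2πa/(LN) < 2π⌊a/L⌋/N + 2π/N`. -/
theorem fineMomentum_lt_blockMomentum_right_add (a : ℕ) :
    2 * π * (a : ℝ) / ((L : ℝ) * N) < 2 * π * ((a / L : ℕ) : ℝ) / N + 2 * π / N := by
  have h := fineMomentum_lt_blockMomentum_left_add (L := N) (N := L) a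
  rwa [mul_comm (N : ℝ) (L : ℝ)] at h

/-- **The two block momenta of one fine point are close**: `|2π⌊a/N⌋/L - 2π⌊a/L⌋/N| < 2π/L + 2π/N` (both lie in
a window of length `2π/L`, resp. `2π/N`, whose right end is the fine momentum `2πa/(LN)`). -/
theorem abs_blockMomentum_sub_lt (a : ℕ) :
    |2 * π * ((a / N : ℕ) : ℝ) / L - 2 * π * ((a / L : ℕ) : ℝ) / N| < 2 * π / L + 2 * π / N := by
  have hL : (0 : ℝ) < L := by exact_mod_cast Nat.pos_of_ne_zero (NeZero.ne L)
  have hN : (0 : ℝ) < N := by exact_mod_cast Nat.pos_of_ne_zero (NeZero.ne N)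
  have h1 := blockMomentum_left_le (L := L) (N := N) a
  have h2 := fineMomentum_lt_blockMomentum_left_add (L := L) (N := N) a
  have h3 := blockMomentum_right_le (L := L) (N := N) a
  have h4 := fineMomentum_lt_blockMomentum_right_add (L := L) (N := N) a
  have hπL : 0 < 2 * π / L := by positivity
  have hπN : 0 < 2 * π / N := by positivity
  rw [abs_sub_lt_iff]
  constructor <;> linarith

omit [NeZero L] in
/-- The momentum of the left block coarsening `⌊j/N⌋ ∈ (ℤ/L)^d` of a fine index `j`, coordinate `i`:
`2π⌊j_i/N⌋/L`. -/
theorem latticeMomentum_blockCoarsen_left (j : Fin d → Fin (L * N)) (i : Fin d) :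
    latticeMomentum L (fun i => (((j i : ℕ) / N : ℕ) : ZMod L)) i = 2 * π * (((j i : ℕ) / N : ℕ) : ℝ) / L := by
  simp only [latticeMomentum, ZMod.val_natCast, Nat.mod_eq_of_lt (div_lt_left_of_lt_mul (j i).isLt)]

omit [NeZero N] in
/-- The momentum of the right block coarsening `⌊j/L⌋ ∈ (ℤ/N)^d` of a fine index `j`, coordinate `i`:
`2π⌊j_i/L⌋/N`. -/
theorem latticeMomentum_blockCoarsen_right (j : Fin d → Fin (L * N)) (i : Fin d) :
    latticeMomentum N (fun i => (((j i : ℕ) / L : ℕ) : ZMod N)) i = 2 * π * (((j i : ℕ) / L : ℕ) : ℝ) / N := by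
  simp only [latticeMomentum, ZMod.val_natCast, Nat.mod_eq_of_lt (div_lt_right_of_lt_mul (j i).isLt)]

/-- **The two coarsenings of one refinement point have close momenta**, coordinatewise:
`|p_L(⌊j/N⌋)_i - p_N(⌊j/L⌋)_i| < 2π/L + 2π/N`. -/
theorem abs_latticeMomentum_blockCoarsen_sub_lt (j : Fin d → Fin (L * N)) (i : Fin d) :
    |latticeMomentum L (fun i => (((j i : ℕ) / N : ℕ) : ZMod L)) i -
        latticeMomentum N (fun i => (((j i : ℕ) / L : ℕ) : ZMod N)) i| < 2 * π / L + 2 * π / N := by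
  rw [latticeMomentum_blockCoarsen_left, latticeMomentum_blockCoarsen_right]
  exact abs_blockMomentum_sub_lt (j i : ℕ)

end Window

/-! ## §2 Exact pull-back of grid sums to the common refinement -/

section Pullback

variable {L N : ℕ} [NeZero L] [NeZero N]

/-- **Exact pull-back (left)**: every fibre of the block coarsening `j ↦ ⌊j/N⌋` to the `L`-grid has `N^d` points
(the refinement index splits as (block, position in the block) through `finProdFinEquiv` coordinatewise), so
`Σ_{j ∈ Fin d → Fin (LN)} G(⌊j/N⌋) = N^d • Σ_{k ∈ (ℤ/L)^d} G k`. -/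
theorem sum_comp_blockCoarsen_left {M : Type*} [AddCommMonoid M] (G : TorusSite d L → M) :
    ∑ j : Fin d → Fin (L * N), G (fun i => (((j i : ℕ) / N : ℕ) : ZMod L)) = N ^ d • ∑ k : TorusSite d L, G k := by
  have hNpos : 0 < N := Nat.pos_of_ne_zero (NeZero.ne N)
  -- the splitting `j ↦ (⌊j/N⌋, j mod N)` and its inverse
  let ψ : (Fin d → Fin (L * N)) → TorusSite d L × (Fin d → Fin N) :=
    fun j => (fun i => (((j i : ℕ) / N : ℕ) : ZMod L), fun i => (j i).modNat)
  let φ : TorusSite d L × (Fin d → Fin N) → (Fin d → Fin (L * N)) :=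
    fun p i => finProdFinEquiv (⟨(p.1 i).val, ZMod.val_lt (p.1 i)⟩, p.2 i)
  have hφψ : Function.LeftInverse φ ψ := by
    intro j
    funext i
    have hdiv : (⟨(((j i : ℕ) / N : ℕ) : ZMod L).val, ZMod.val_lt _⟩ : Fin L) = (j i).divNat := by
      ext
      simp only [ZMod.val_natCast, Nat.mod_eq_of_lt (div_lt_left_of_lt_mul (j i).isLt), Fin.coe_divNat]
    change finProdFinEquiv (⟨(((j i : ℕ) / N : ℕ) : ZMod L).val, ZMod.val_lt _⟩, (j i).modNat) = j i
    rw [hdiv]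
    exact finProdFinEquiv.apply_symm_apply (j i)
  have hψφ : Function.RightInverse φ ψ := by
    rintro ⟨k, r⟩
    refine Prod.ext ?_ ?_
    · funext i
      change ((((finProdFinEquiv (⟨(k i).val, ZMod.val_lt (k i)⟩, r i) : Fin (L * N)) : ℕ) / N : ℕ) : ZMod L) = k i
      rw [finProdFinEquiv_apply_val, Nat.add_mul_div_left _ _ hNpos, Nat.div_eq_of_lt (r i).isLt, zero_add,
        ZMod.natCast_zmod_val]
    · funext i
      have h := congrArg Prod.snd (finProdFinEquiv.symm_apply_apply (⟨(k i).val, ZMod.val_lt (k i)⟩, r i))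
      simpa only [finProdFinEquiv_symm_apply] using h
  have hψ : Function.Bijective ψ := Function.bijective_iff_has_inverse.2 ⟨φ, hφψ, hψφ⟩
  calc ∑ j : Fin d → Fin (L * N), G (fun i => (((j i : ℕ) / N : ℕ) : ZMod L))
      = ∑ j : Fin d → Fin (L * N), (fun p : TorusSite d L × (Fin d → Fin N) => G p.1) (ψ j) := rfl
    _ = ∑ p : TorusSite d L × (Fin d → Fin N), G p.1 := hψ.sum_comp (fun p => G p.1)
    _ = ∑ k : TorusSite d L, ∑ _r : Fin d → Fin N, G k := Fintype.sum_prod_type _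
    _ = N ^ d • ∑ k : TorusSite d L, G k := by
        simp only [Finset.sum_const, Finset.card_univ, Fintype.card_fun, Fintype.card_fin, Finset.smul_sum]

/-- **Exact pull-back (right)**: `Σ_{j ∈ Fin d → Fin (LN)} G(⌊j/L⌋) = L^d • Σ_{k' ∈ (ℤ/N)^d} G k'` (the left
statement on the transposed refinement `Fin (N * L)`, transported along `Fin.cast`). -/
theorem sum_comp_blockCoarsen_right {M : Type*} [AddCommMonoid M] (G : TorusSite d N → M) :
    ∑ j : Fin d → Fin (L * N), G (fun i => (((j i : ℕ) / L : ℕ) : ZMod N)) = L ^ d • ∑ k : TorusSite d N, G k := by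
  rw [← sum_comp_blockCoarsen_left (d := d) (L := N) (N := L) G]
  refine Fintype.sum_equiv (Equiv.piCongrRight fun _ : Fin d => finCongr (Nat.mul_comm L N)) _ _ fun j => ?_
  rfl

/-- **The `L`-grid average is a fine average**: `L^{-d} Σ_k G k = (LN)^{-d} Σ_{j ∈ Fin d → Fin (LN)} G(⌊j/N⌋)`. -/
theorem gridAverage_eq_fineAverage_left (G : TorusSite d L → E) :
    ((L ^ d : ℕ) : ℝ)⁻¹ • ∑ k : TorusSite d L, G k =
      (((L * N) ^ d : ℕ) : ℝ)⁻¹ • ∑ j : Fin d → Fin (L * N), G (fun i => (((j i : ℕ) / N : ℕ) : ZMod L)) := by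
  have hL : ((L : ℝ) ^ d) ≠ 0 := pow_ne_zero d (by exact_mod_cast NeZero.ne L)
  have hN : ((N : ℝ) ^ d) ≠ 0 := pow_ne_zero d (by exact_mod_cast NeZero.ne N)
  rw [sum_comp_blockCoarsen_left, ← Nat.cast_smul_eq_nsmul ℝ, smul_smul]
  congr 1
  push_cast
  rw [mul_pow]
  field_simp

/-- **The `N`-grid average is a fine average**: `N^{-d} Σ_{k'} G k' = (LN)^{-d} Σ_{j ∈ Fin d → Fin (LN)} G(⌊j/L⌋)`. -/
theorem gridAverage_eq_fineAverage_right (G : TorusSite d N → E) :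
    ((N ^ d : ℕ) : ℝ)⁻¹ • ∑ k : TorusSite d N, G k =
      (((L * N) ^ d : ℕ) : ℝ)⁻¹ • ∑ j : Fin d → Fin (L * N), G (fun i => (((j i : ℕ) / L : ℕ) : ZMod N)) := by
  have hL : ((L : ℝ) ^ d) ≠ 0 := pow_ne_zero d (by exact_mod_cast NeZero.ne L)
  have hN : ((N : ℝ) ^ d) ≠ 0 := pow_ne_zero d (by exact_mod_cast NeZero.ne N)
  rw [sum_comp_blockCoarsen_right, ← Nat.cast_smul_eq_nsmul ℝ, smul_smul]
  congr 1
  push_cast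
  rw [mul_pow]
  field_simp

end Pullback

/-! ## §3 Two-volume comparison of grid-only families -/

section TwoVolume

variable {L L' : ℕ} [NeZero L] [NeZero L']

/-- **Two-volume comparison of grid averages from a cross-volume modulus alone.**  If two families `F` on
`(ℤ/L)^d` and `F'` on `(ℤ/L')^d` satisfy `‖F k - F' k'‖ ≤ ε` for every pair of grid points whose momenta are
coordinatewise within `2π/L + 2π/L'`, then `‖L^{-d} Σ_k F k - L'^{-d} Σ_{k'} F' k'‖ ≤ ε`.  (Both averages are
averages over the common refinement `Fin d → Fin (L L')`, where the two coarse points of every fine point are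
that close; average the pointwise bound.)  No continuum integrand, no Lipschitz hypothesis — the form needed
for families defined only on the grids. -/
theorem norm_gridAverage_sub_gridAverage_le (F : TorusSite d L → E) (F' : TorusSite d L' → E) {ε : ℝ}
    (h : ∀ (k : TorusSite d L) (k' : TorusSite d L'),
      (∀ i, |latticeMomentum L k i - latticeMomentum L' k' i| < 2 * π / L + 2 * π / L') → ‖F k - F' k'‖ ≤ ε) :
    ‖((L ^ d : ℕ) : ℝ)⁻¹ • ∑ k : TorusSite d L, F k - ((L' ^ d : ℕ) : ℝ)⁻¹ • ∑ k' : TorusSite d L', F' k'‖ ≤ ε := by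
  rw [gridAverage_eq_fineAverage_left (N := L') F, gridAverage_eq_fineAverage_right (L := L) F', ← smul_sub,
    ← Finset.sum_sub_distrib]
  have hLL : (0 : ℝ) < (((L * L') ^ d : ℕ) : ℝ) := by
    have : 0 < L * L' := Nat.mul_pos (Nat.pos_of_ne_zero (NeZero.ne L)) (Nat.pos_of_ne_zero (NeZero.ne L'))
    exact_mod_cast pow_pos this d
  have hcard : (Finset.univ : Finset (Fin d → Fin (L * L'))).card = (L * L') ^ d := by
    simp only [Finset.card_univ, Fintype.card_fun, Fintype.card_fin]
  have hpt : ∀ j : Fin d → Fin (L * L'),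
      ‖F (fun i => (((j i : ℕ) / L' : ℕ) : ZMod L)) - F' (fun i => (((j i : ℕ) / L : ℕ) : ZMod L'))‖ ≤ ε :=
    fun j => h _ _ fun i => abs_latticeMomentum_blockCoarsen_sub_lt j i
  calc ‖(((L * L') ^ d : ℕ) : ℝ)⁻¹ • ∑ j : Fin d → Fin (L * L'),
          (F (fun i => (((j i : ℕ) / L' : ℕ) : ZMod L)) - F' (fun i => (((j i : ℕ) / L : ℕ) : ZMod L')))‖
      ≤ (((L * L') ^ d : ℕ) : ℝ)⁻¹ * ∑ j : Fin d → Fin (L * L'),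
          ‖F (fun i => (((j i : ℕ) / L' : ℕ) : ZMod L)) - F' (fun i => (((j i : ℕ) / L : ℕ) : ZMod L'))‖ := by
        rw [norm_smul, norm_inv, Real.norm_of_nonneg hLL.le]
        gcongr
        exact norm_sum_le _ _
    _ ≤ (((L * L') ^ d : ℕ) : ℝ)⁻¹ * ∑ _j : Fin d → Fin (L * L'), ε := by
        gcongr with j _
        exact hpt j
    _ = ε := by
        have hne : ((L : ℝ) * L') ^ d ≠ 0 :=
          pow_ne_zero d (mul_ne_zero (by exact_mod_cast NeZero.ne L) (by exact_mod_cast NeZero.ne L'))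
        rw [Finset.sum_const, hcard, nsmul_eq_mul]
        push_cast
        field_simp

/-- **Two-volume comparison with a linear modulus.**  If `‖F k - F' k'‖ ≤ ρ + D · Σ_i |2πk_i/L - 2πk'_i/L'|`
for all pairs of grid points (`0 ≤ D`), then the averages are within `ρ + D · d · (2π/L + 2π/L')`: the modulus
constant becomes a RATE.  (Consumers with the torus distance `dist(·, 2πℤ) ≤ |·|` in the modulus get the same
conclusion a fortiori: `…VolumeLimitGridFamilies`.) -/
theorem norm_gridAverage_sub_gridAverage_le_of_modulus (F : TorusSite d L → E) (F' : TorusSite d L' → E)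
    {ρ D : ℝ} (hD : 0 ≤ D)
    (h : ∀ (k : TorusSite d L) (k' : TorusSite d L'),
      ‖F k - F' k'‖ ≤ ρ + D * ∑ i, |latticeMomentum L k i - latticeMomentum L' k' i|) :
    ‖((L ^ d : ℕ) : ℝ)⁻¹ • ∑ k : TorusSite d L, F k - ((L' ^ d : ℕ) : ℝ)⁻¹ • ∑ k' : TorusSite d L', F' k'‖ ≤
      ρ + D * (d * (2 * π / L + 2 * π / L')) := by
  refine norm_gridAverage_sub_gridAverage_le F F' fun k k' hkk' => (h k k').trans ?_
  gcongr
  calc ∑ i, |latticeMomentum L k i - latticeMomentum L' k' i| ≤ ∑ _i : Fin d, (2 * π / L + 2 * π / L') :=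
        Finset.sum_le_sum fun i _ => (hkk' i).le
    _ = d * (2 * π / L + 2 * π / L') := by
        rw [Finset.sum_const, Finset.card_univ, Fintype.card_fin, nsmul_eq_mul]

end TwoVolume

end Summit.HubbardSuperconductivity.HubbardSuperconductivity.Theorems.KLRegimeSplit

end
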